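/-
Copyright (c) 2026 the pub-hodgecm-mathlib formalisation cell (harness21).  Prover seat hodgecm-mathlib-K2Liu-p02 (g4), Track B «K2-LIT» ∕
hLiu418 #184♮, socket #42N «MODEL IDENTIFICATION» of the #42R road, FILE (P1) of road (N″) «by the see-saw permutation»
(LEAD F0P6-plan (g11) ruling «M-155k», census `K2/K2Liu-p02/g4/CENSUS-42N-ModelIdentification-Ikeda.K2Liup02g4.md`), 2026-09-04.
-/
import Literature.NumberTheory.GelbartRogawski1991.DoubledSeesawUndoubling

/-!
# Crux `HLiu418`, road `K2_Liu`, socket #42N — FILE (P1): the embedding `inlG (x ⊗ 1)` of the pair datum `(V₁ ⊕ V₂, W)` is the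
# see-saw embedding `blkD (·, 1)` CONJUGATED BY A RATIONAL PERMUTATION of the doubled coordinates

Cell `hodgecm-mathlib`, crux item hLiu418 = `stmt-HodgeConjecture-24832`; squad K2 ∕ K2Liu, prover K2Liu-p02 (g4), steward lineage of socket #42R.
THEOREMS + two plumbing definitions with bodies (`rowEquiv`, `seesawPerm` — index shuffles — and `permGL`, the permutation matrix as a `GL`
element); no instance ∕ notation ∕ named-fact hypothesis ∕ `sorry`; lane `--supports stmt-HodgeConjecture-24832 --as helper` (count-neutral).

ROAD (N″) FOR #42N (model (ii) = model (i)).  Model (ii) of socket #42R — ★ `chiSplittingLine = undoubleHom (doubledWeilRep χ)` of the PAIR datum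
`(V := dD = (t₀ ‖ −t₀), W := ⟨a′⟩)` restricted to `U(𝔻) = U(V)` — is read through ★ `inlG : G₁(𝔸) →* H(V)(𝔸)`, `Y ↦ Y ⊕ 1` on the doubled space
`𝕎_V ⊕ 𝕎_V⁻`; the doubled see-saw of ★ `DoubledBlockDiagEmbedding` ∕ ★ `DoubledSeesawParabolic` reads `H(V₁)(𝔸) × H(V₂)(𝔸)` through
★ `blkD : (h₁, h₂) ↦ σ⁻¹-reindex of diag(h₁, h₂)`, `σ = idxSplitD` (`𝕎_V ⊕ 𝕎_V⁻ = (𝕎_{V₁} ⊕ 𝕎_{V₁}⁻) ⊕ (𝕎_{V₂} ⊕ 𝕎_{V₂}⁻)`), and proves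
★ `omega_blkD_inl_sumTensor`: `ω(sD_V (blkD (h₁, 1)))(Φ₁ ⊠_σ Φ₂) = ω(sD_{V₁} h₁)Φ₁ ⊠_σ Φ₂` for ALL `h₁` (the parabolic comparison is INSIDE).  For
`V₂ = −V₁` the group `H(V₁) = U(V₁ ⊕ V₁⁻)` is `U(V₁ ⊕ V₂) = U(V) = G₁` itself, and THIS FILE supplies the GROUP-LEVEL bridge between the two
embeddings of `U(V)` into `H(V)(𝔸)`:

* §1 index shuffles: `rowEquiv e₁ : Fin (N+N) ≃ Fin n_V` (`k ↦ e₁ (k, 0)`, `M = 1`) and the permutation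
  **`seesawPerm e₁ e₀ : Fin (n_V + n_V) ≃ Fin (n_V + n_V)`**, `σ (seesawPerm i) = (rowEquiv⁻¹ ⊕ rowEquiv⁻¹)(e₂⁻¹ i)` (`idxSplitD_seesawPerm`)
  — the swap «`V₂` of copy 1 ↔ `V₁⁻` of copy 2» of the census, in the tree's enumerations;
* §2 `permGL ρ : GL m R` (matrix `ρ⁻¹.toPEquiv.toMatrix`, inverse `ρ.toPEquiv.toMatrix`) with `permGL_inv_mul_mul : (permGL ρ)⁻¹ M (permGL ρ) = M.submatrix ρ ρ`,
  stability under ring maps (`map_permGL`);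
* §3 **`coe_inlG_eq_conj_blkD`** — for `Y ∈ G₁(𝔸)` (index `Fin (N+N) × Fin 1`) and `h₁ ∈ H(V₁)(𝔸)` (index `Fin (N+N)`, `e₀ : Fin N × Fin 1 ≃ Fin N`) with
  THE SAME MATRIX (`Y (k,0) (k′,0) = h₁ k k′`): the `GL`-matrix of `inlG Y` is `(permGL ρ)⁻¹ · blkD (h₁, 1) · permGL ρ`, `ρ = seesawPerm e₁ e₀` — as
  matrices in `GL_{n_V+n_V}(𝔸_L)`.  (The unitarity and rationality of `permGL ρ` in `H(V)(𝔸)` — `σ` preserves the diagonal doubled Gram — and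
  the assembly with ★ `omega_blkD_inl_sumTensor` ∕ ★ `omega_uD_tensorToSum` are FILES (P2)–(P3).)

HONEST LABEL.  Count-neutral helper; it pays nothing by itself: `HC_CM` is proved only modulo the 7 printed citations (2 remaining named inputs:
hLiu418 = `stmt-HodgeConjecture-24832`, h413 = `stmt-HodgeConjecture-24833`) until rung 0 closes.
References: [Kudla1994] §2, Thm. 3.1 (doubled space, Siegel parabolic); [HarrisKudlaSweet1996] §1 (1.14)–(1.15), App. A Lem. A.2–Cor. A.3
(«`ι̃_{V,χ}` is determined by doubling»); [Kudla1984] §1 (see-saw pairs); [GelbartRogawski1991] §3.1 Prop. 3.1.1.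
-/

set_option autoImplicit false
-- the mandated namespace repeats the single-problem summit's segment (`HodgeConjecture.HodgeConjecture`)
set_option linter.dupNamespace false

noncomputable section

open scoped Classical Matrix Kronecker
open NumberField IsDedekindDomain
open Literature.NumberTheory.Automorphic Literature.NumberTheory.GelbartRogawski1991.GRConstruction

namespace Summit.HodgeConjecture.HodgeConjecture.Cruxes.HLiu418.K2LiuUndoublingSeesawPermutation

/-! ## §1 Index shuffles -/

section Index

variable {N nV : ℕ} (e₁ : Fin (N + N) × Fin 1 ≃ Fin nV) (e₀ : Fin N × Fin 1 ≃ Fin N)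

/-- `rowEquiv e₁ : Fin (N+N) ≃ Fin n_V`, `k ↦ e₁ (k, 0)` (the partner has rank `M = 1`). [cite: Kudla1984, §1] -/
def rowEquiv : Fin (N + N) ≃ Fin nV := (Equiv.prodUnique (Fin (N + N)) (Fin 1)).symm.trans e₁

/-- `rowEquiv⁻¹ a = (e₁⁻¹ a).1`. [cite: Kudla1984, §1] -/
@[simp] theorem rowEquiv_symm_apply (a : Fin nV) : (rowEquiv e₁).symm a = (e₁.symm a).1 := rfl

/-- `e₁⁻¹ a = (rowEquiv⁻¹ a, 0)`. [cite: Kudla1984, §1] -/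
theorem e₁_symm_eq (a : Fin nV) : e₁.symm a = ((rowEquiv e₁).symm a, 0) :=
  Prod.ext rfl (Subsingleton.elim _ _)

/-- **the see-saw permutation** `ρ = σ⁻¹ ∘ (rowEquiv⁻¹ ⊕ rowEquiv⁻¹) ∘ e₂⁻¹` of the doubled coordinates `Fin (n_V + n_V)`,
`σ = idxSplitD e₁ e₀ e₀`. [cite: Kudla1984, §1] [cite: Kudla1994, §2 (doubled space, Siegel parabolic)] -/
def seesawPerm : Fin (nV + nV) ≃ Fin (nV + nV) :=
  ((finSumFinEquiv (m := nV) (n := nV)).symm.trans ((rowEquiv e₁).symm.sumCongr (rowEquiv e₁).symm)).trans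
    (idxSplitD e₁ e₀ e₀).symm

/-- `σ (ρ i) = (rowEquiv⁻¹ ⊕ rowEquiv⁻¹)(e₂⁻¹ i)`. [cite: Kudla1984, §1] -/
theorem idxSplitD_seesawPerm (i : Fin (nV + nV)) :
    idxSplitD e₁ e₀ e₀ (seesawPerm e₁ e₀ i) =
      Sum.map (rowEquiv e₁).symm (rowEquiv e₁).symm ((finSumFinEquiv (m := nV) (n := nV)).symm i) := by
  simp only [seesawPerm, Equiv.trans_apply, Equiv.apply_symm_apply, Equiv.sumCongr_apply]

/-- the same at `i = e₂ z`. [cite: Kudla1984, §1] -/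
theorem idxSplitD_seesawPerm_finSumFinEquiv (z : Fin nV ⊕ Fin nV) :
    idxSplitD e₁ e₀ e₀ (seesawPerm e₁ e₀ (finSumFinEquiv z)) = Sum.map (rowEquiv e₁).symm (rowEquiv e₁).symm z := by
  rw [idxSplitD_seesawPerm, Equiv.symm_apply_apply]

end Index

/-! ## §2 Permutation matrices as `GL` elements -/

section Perm

variable {R : Type*} [CommRing R] {m : Type*} [Fintype m] [DecidableEq m]

/-- **`permGL ρ`**: the `GL` element with matrix `ρ⁻¹.toPEquiv.toMatrix` and inverse `ρ.toPEquiv.toMatrix`, so that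
`(permGL ρ)⁻¹ · M · permGL ρ = M.submatrix ρ ρ`. [cite: Kudla1984, §1] -/
def permGL (ρ : m ≃ m) : GL m R where
  val := ρ.symm.toPEquiv.toMatrix
  inv := ρ.toPEquiv.toMatrix
  val_inv := by rw [← PEquiv.toMatrix_trans, ← Equiv.toPEquiv_trans, Equiv.symm_trans_self, Equiv.toPEquiv_refl, PEquiv.toMatrix_refl]
  inv_val := by rw [← PEquiv.toMatrix_trans, ← Equiv.toPEquiv_trans, Equiv.self_trans_symm, Equiv.toPEquiv_refl, PEquiv.toMatrix_refl]

/-- matrix of `permGL ρ`. [cite: Kudla1984, §1] -/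
@[simp] theorem coe_permGL (ρ : m ≃ m) : ((permGL ρ : GL m R) : Matrix m m R) = ρ.symm.toPEquiv.toMatrix := rfl

/-- matrix of `(permGL ρ)⁻¹`. [cite: Kudla1984, §1] -/
@[simp] theorem coe_permGL_inv (ρ : m ≃ m) : (((permGL ρ)⁻¹ : GL m R) : Matrix m m R) = ρ.toPEquiv.toMatrix := rfl

/-- **conjugation by a permutation matrix is re-indexing**: `(permGL ρ)⁻¹ · M · permGL ρ = M.submatrix ρ ρ`. [cite: Kudla1984, §1] -/
theorem permGL_inv_mul_mul (ρ : m ≃ m) (M : Matrix m m R) :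
    (((permGL ρ)⁻¹ : GL m R) : Matrix m m R) * M * ((permGL ρ : GL m R) : Matrix m m R) = M.submatrix ρ ρ := by
  rw [coe_permGL_inv, coe_permGL, PEquiv.toMatrix_toPEquiv_mul, PEquiv.mul_toMatrix_toPEquiv, Equiv.symm_symm,
    Matrix.submatrix_submatrix]
  rfl

omit [Fintype m] in
/-- a permutation matrix is fixed by every entrywise ring map. [cite: Kudla1984, §1] -/
theorem toPEquiv_toMatrix_map {S : Type*} [CommRing S] (ρ : m ≃ m) (f : R →+* S) :
    (ρ.toPEquiv.toMatrix : Matrix m m R).map f = ρ.toPEquiv.toMatrix := by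
  ext i j
  simp only [Matrix.map_apply, PEquiv.toMatrix_apply, Equiv.toPEquiv_apply, Option.mem_def, Option.some.injEq]
  split_ifs <;> simp

/-- `permGL` commutes with entrywise ring maps. [cite: Kudla1984, §1] -/
theorem map_permGL {S : Type*} [CommRing S] (ρ : m ≃ m) (f : R →+* S) :
    Matrix.GeneralLinearGroup.map f (permGL ρ : GL m R) = (permGL ρ : GL m S) :=
  Units.ext (toPEquiv_toMatrix_map ρ.symm f)

end Perm

/-! ## §3 `inlG (x ⊗ 1)` is `blkD (x, 1)` conjugated by the see-saw permutation -/

section Conj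

variable (L : Type) [Field L] [NumberField L] [IsCMField L]
variable {N nV : ℕ} (e₁ : Fin (N + N) × Fin 1 ≃ Fin nV) (e₀ : Fin N × Fin 1 ≃ Fin N)
  (dA : Fin N → L) (hdA : ∀ i, IsCMField.complexConj L (dA i) = dA i)
  (dB : Fin N → L) (hdB : ∀ i, IsCMField.complexConj L (dB i) = dB i)
  (dV : Fin (N + N) → L) (hdV : ∀ i, IsCMField.complexConj L (dV i) = dV i)
  (hVA : ∀ i, dV (Fin.castAdd N i) = dA i) (hVB : ∀ j, dV (Fin.natAdd N j) = dB j)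
  (dW : Fin 1 → L) (hdW : ∀ i, IsCMField.complexConj L (dW i) = dW i)

omit [IsCMField L] in
/-- the entry identity behind §3: `fromBlocks (reindex e₁ Y) 0 0 1 z z′ = fromBlocks X 0 0 1 ((rowEquiv⁻¹ ⊕ rowEquiv⁻¹) z) ((rowEquiv⁻¹ ⊕ rowEquiv⁻¹) z′)`
when `Y (k,0) (k′,0) = X k k′`. [cite: Kudla1984, §1] -/
theorem fromBlocks_reindex_eq (Y : Matrix (Fin (N + N) × Fin 1) (Fin (N + N) × Fin 1) (AdeleRing (𝓞 L) L)) (X : Matrix (Fin (N + N)) (Fin (N + N)) (AdeleRing (𝓞 L) L))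
    (hY : ∀ k k' : Fin (N + N), Y (k, (0 : Fin 1)) (k', (0 : Fin 1)) = X k k') (z z' : Fin nV ⊕ Fin nV) :
    Matrix.fromBlocks (Matrix.reindex e₁ e₁ Y) 0 0 (1 : Matrix (Fin nV) (Fin nV) (AdeleRing (𝓞 L) L)) z z' =
      Matrix.fromBlocks X 0 0 (1 : Matrix (Fin (N + N)) (Fin (N + N)) (AdeleRing (𝓞 L) L))
        (Sum.map (rowEquiv e₁).symm (rowEquiv e₁).symm z) (Sum.map (rowEquiv e₁).symm (rowEquiv e₁).symm z') := by
  rcases z with a | a <;> rcases z' with b | b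
  · simp only [Matrix.fromBlocks_apply₁₁, Sum.map_inl, Matrix.reindex_apply, Matrix.submatrix_apply, e₁_symm_eq e₁, hY]
  · simp only [Matrix.fromBlocks_apply₁₂, Sum.map_inl, Sum.map_inr, Matrix.zero_apply]
  · simp only [Matrix.fromBlocks_apply₂₁, Sum.map_inl, Sum.map_inr, Matrix.zero_apply]
  · simp only [Matrix.fromBlocks_apply₂₂, Sum.map_inr, Matrix.one_apply, (rowEquiv e₁).symm.injective.eq_iff]

/-- **`inlG Y = (permGL ρ)⁻¹ · blkD (h₁, 1) · permGL ρ` as `GL`-matrices** (`ρ = seesawPerm e₁ e₀`): the embedding `Y ↦ Y ⊕ 1` of the pair datum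
`(V₁ ⊕ V₂, W)` (★ `inlG`) is the see-saw embedding `h₁ ↦ blkD (h₁, 1)` of ★ `DoubledBlockDiagEmbedding` conjugated by the see-saw permutation,
for any `Y ∈ G₁(V)(𝔸)` and `h₁ ∈ H(V₁)(𝔸)` with the same matrix (`Y (k,0) (k′,0) = h₁ k k′`; for `V₂ = −V₁` every `Y = x ⊗ 1`, `x ∈ U(V)(𝔸)`, has such
an `h₁` — FILE (P3)).  This is the group-level half of «`ι̃_{V,χ}` is determined by doubling».
[cite: HarrisKudlaSweet1996, App. A Lem. A.2] [cite: Kudla1994, §2 (doubled space, Siegel parabolic)] [cite: Kudla1984, §1] -/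
theorem coe_inlG_eq_conj_blkD
    (Y : ↥(UnitaryGroup.adelicPair (Fp L) L (IsCMField.complexConj L) (N + N) 1 (Matrix.diagonal dV) (Matrix.diagonal dW)))
    (h₁ : HA L e₀ dA hdA dW hdW)
    (hY : ∀ k k' : Fin (N + N),
      ((Y : GL (Fin (N + N) × Fin 1) (AdeleRing (𝓞 L) L)) : Matrix (Fin (N + N) × Fin 1) (Fin (N + N) × Fin 1) (AdeleRing (𝓞 L) L)) (k, (0 : Fin 1)) (k', (0 : Fin 1)) =
      ((h₁ : GL (Fin (N + N)) (AdeleRing (𝓞 L) L)) : Matrix (Fin (N + N)) (Fin (N + N)) (AdeleRing (𝓞 L) L)) k k') :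
    (((inlG L e₁ dV hdV dW hdW Y : HA L e₁ dV hdV dW hdW) : GL (Fin (nV + nV)) (AdeleRing (𝓞 L) L)) : Matrix (Fin (nV + nV)) (Fin (nV + nV)) (AdeleRing (𝓞 L) L)) =
      (((permGL (seesawPerm e₁ e₀))⁻¹ : GL (Fin (nV + nV)) (AdeleRing (𝓞 L) L)) : Matrix _ _ (AdeleRing (𝓞 L) L)) *
        (((blkD L e₁ e₀ e₀ dA hdA dB hdB dV hdV hVA hVB dW hdW (h₁, 1) : HA L e₁ dV hdV dW hdW) : GL (Fin (nV + nV)) (AdeleRing (𝓞 L) L)) :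
          Matrix _ _ (AdeleRing (𝓞 L) L)) *
        ((permGL (seesawPerm e₁ e₀) : GL (Fin (nV + nV)) (AdeleRing (𝓞 L) L)) : Matrix _ _ (AdeleRing (𝓞 L) L)) := by
  rw [permGL_inv_mul_mul]
  ext i j
  obtain ⟨z, rfl⟩ := (finSumFinEquiv (m := nV) (n := nV)).surjective i
  obtain ⟨z', rfl⟩ := (finSumFinEquiv (m := nV) (n := nV)).surjective j
  rw [coe_coe_inlG_apply, Matrix.submatrix_apply, coe_coe_blkD_apply, idxSplitD_seesawPerm_finSumFinEquiv,
    idxSplitD_seesawPerm_finSumFinEquiv, fromBlocks_reindex_eq L e₁ _ _ hY]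
  simp only [OneMemClass.coe_one, Units.val_one]

end Conj

end Summit.HodgeConjecture.HodgeConjecture.Cruxes.HLiu418.K2LiuUndoublingSeesawPermutation

end
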